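import Mathlib.MeasureTheory.Integral.IntervalIntegral.Basic
import Literature.MathematicalPhysics.QuantumLattice.HubbardSchwingerFunction
import Literature.MathematicalPhysics.QuantumLattice.FermiRG.BGM2003Sectors
import HarnessLib

/-!
# Benfatto–Giuliani–Mastropietro 2003, Theorem 1.1: the two-point Schwinger function of a weakly
interacting 2D Fermi system with symmetric Fermi surface down to `T ≥ exp{-(c₀|λ|)⁻¹}` —
the COUNTERTERM version, lattice models

Topic `Literature/MathematicalPhysics/QuantumLattice/FermiRG`; statements-first typing (D-0069 (2)
typer wave, seat t3, DAG file F3a) of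

* G. Benfatto, A. Giuliani, V. Mastropietro, *Low temperature analysis of two-dimensional Fermi
  systems with symmetric Fermi surface*, Ann. Henri Poincaré 4 (2003) 137–193,
  arXiv:cond-mat/0207210 [BenfattoGiulianiMastropietro2003]. Locators `p.N (Ln)` = N-th 3000-character
  chunk (line n) of the materialised arXiv TeX; theorem / equation numbers are the printed ones.

## The printed theorem (p.5 L1–15, eq. (2.11)) and what is typed

«There exist two positive constants `ε` and `c₀`, the last one only depending on first and second
order terms in the perturbative expansion, and a continuous function `ν̂(k⃗, λ) = O(λ)`, such that,
for all `|λ| ≤ ε` and `T ≥ exp{-(c₀|λ|)⁻¹}`, `Ŝ(k) = ĝ(k)(1 + λŜ₁(k))` (2.11), where `ĝ(k)` is the free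
propagator at finite `β` and `|Ŝ₁(k)| ≤ c`, for some constant `c`. In the continuum case with
`ε(k⃗) = |k⃗|²/2m` and `v(x⃗) = ṽ(|x⃗|)`, there exists another constant `c₁` such that, if `|λ| ≤ ε` and
`T ≥ exp{-(c₁|λ|)⁻¹}`, `ν̂(k⃗, λ) = ν(λ)` is a constant.»

The model (§1.2, p.3 L86 – p.4 L146) is the Grassmann functional integral (2.9) with free propagator
`ĝ(k) = C̄₀⁻¹(k⃗)/(-ik₀ + ε(k⃗) - μ)` (2.1)–(2.2), the quartic interaction
`𝒱 = λ Σ_{σσ'} ∫dx dy δ(x₀-y₀) v_{σσ'}(x⃗-y⃗) ψ⁺_{xσ}ψ⁻_{xσ}ψ⁺_{yσ'}ψ⁻_{yσ'}` (2.8) and the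
COUNTERTERM `𝒩 = (L²β)⁻¹ Σ_k ν̂(k⃗,λ) ψ̂⁺_k ψ̂⁻_k` (2.10), `δε = C̄₀⁻¹ν̂` being the shift
`ε₀ = ε + δε` of the physical dispersion `ε₀` (p.3 L70–77): the theorem is about the model whose
INTERACTING Fermi surface is `{ε = μ}`. **The inversion `ε₀ = ε + ν̂ ↦ ε` is declared OPEN by the
authors** (p.5 L44–64: «We did not yet get this result») — it is NOT typed here, neither as a fact
nor as a hypothesis; in particular nothing here is a statement about the bare Hubbard model at fixed
`(ε₀, μ)` (ref-2 trap "drop-ν̂").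

TYPED: `BGM2003.theorem11_lattice` — the LATTICE-model case (`C̄₀⁻¹ = 1`, p.4 L26–27; e.g. the
Hubbard dispersion `2 - cos k₁ - cos k₂` with `v = δ_{σ,-σ'}δ_{x⃗,y⃗}`, Remark p.4 L125–135), realised —
as the paper's Remark p.4 L125–129 licenses («the Grassmanian functional integrals (2.9) are equal,
in the limit `M → ∞`, to the Schwinger functions of an Hamiltonian model of fermions») — by the
Hamiltonian on the discrete torus `(ℤ/Lℤ)²` built from the tree's Fock-space operators
(`dGamma`, `creation`, `annihilation`, `Matrix.schwingerTwoPoint` of `HubbardSchwingerFunction`):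
one-body symbol `ε(k⃗) - μ + ν̂(k⃗,λ)` on the torus momenta `2πn⃗/L`, normal-ordered density–density
interaction `λ Σ v^L_{σσ'}(x⃗-y⃗) a⁺_{xσ}a⁺_{yσ'}a⁻_{yσ'}a⁻_{xσ}` (the operator whose coherent-state
action is (2.8); `v^L` = periodisation of `v` to the torus — the finite-`L` boundary convention,
left implicit in the paper, disappears in the limit `L → ∞` of (2.9)), the limit `L → ∞` of (2.9),
and the Fourier transform `Ŝ(k) = ∫₀^β dx₀ Σ_{x⃗ ∈ ℤ²} e^{i(k₀x₀ + k⃗·x⃗)} S(x₀, x⃗)` at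
`k₀ ∈ (2π/β)(ℤ + ½)` (conventions (2.3)–(2.4)). The temperature condition
`T ≥ exp{-(c₀|λ|)⁻¹}` is written `c₀|λ| log β ≤ 1` (equivalent for `λ ≠ 0`, and the printed
"all `T`" at `λ = 0`; this is also the form of the paper's Theorem 4.2, p.22 L59–60).

NOT TYPED (recorded as gap G-t3-01 in the cell's GAP-LEDGER): the CONTINUUM-model half of the model
class (ultraviolet cutoff `C̄₀⁻¹ = H(ε - μ)`, `M → ∞` limit of the auxiliary lattice, p.3 L95 –
p.4 L32) and the jellium clause «`ν̂ = ν(λ)` constant for `T ≥ exp{-(c₁|λ|)⁻¹}`» — the tree has no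
continuum fermionic Fock space / Grassmann Schwinger functions. `-- TODO(general form)`.

## Also in this file (docstring-level only, no declarations)

The technical statements of §2–§4 are phrased on the tree expansion (trees `τ ∈ 𝒯_{h,n}`, modified
running coupling functions, `J_{h,n}(2l₀,q₀)` of (3.47)) whose vocabulary the tree does not have;
they are wave-optional rows and are NOT declared here: Lemma 2.2 [lm3.2] (p.15 L46–65: hypotheses
(3.58)–(3.60) on the MRCF), Theorem 2.1 [th3.1] (p.16 L35–39: `J_{h,n}(2l₀,q₀) ≤ (c|λ|)ⁿ γ^{h[-q₀+δ_ext(2l₀)]}`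
under (3.58)–(3.60)), Theorem 4.1 (p.20 L85), Lemma 4.1 (p.21 L115), Theorem 4.2 (p.22 L59: for `|λ|`
small and `C_{1,2}|λ| log β ≤ 1` one can choose `ν̃₁` so that the MRCF satisfy (3.58)–(3.60)); the
sector-propagator bounds Lemma 2.1 [lm3.1] (3.22) and Lemma 6.1 (jellium) are the general-dispersion
twins of the tree's PROVED `SectorPropagatorDecay.sectorPropagator_decay` (Hubbard band).

## Relation to the tree

`Literature.MathematicalPhysics.QuantumLattice.bgm_two_point_limit` (`HubbardFermiLiquid`) is the
named fact for BGM **2006** Thm 1.1 (Hubbard, NO counterterm, `μ ∈ (-4, -2-√2)` in the tree's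
normalisation); the present 2003 theorem is a DIFFERENT statement (general symmetric dispersion, WITH
counterterm) and is not a restatement of it. Normalisations: BGM's Hubbard example
`ε(k⃗) = 2 - cos k₁ - cos k₂` (band `[0,4]`, hopping `½`) maps to the tree's `sqDispersion = -2(cos k₁ +
cos k₂)` by `ε_tree = 2ε - 4`, `μ_tree = 2μ - 4` (not used here: `ε` is abstract).

Nothing here asserts anything about H1, K1 or K3.
-/

noncomputable section

open Real Set Filter MeasureTheory
open scoped Topology
open Literature.Probability.LatticeModels

namespace Literature.MathematicalPhysics.QuantumLattice.FermiRG

namespace BGM2003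

/-! ### §1.2 (2), lattice models: the model on the torus `(ℤ/Lℤ)²` -/

/-- The torus momenta `k⃗ = 2πn⃗/L`, `n⃗ ∈ {0,…,L-1}²` (any full period of the Brillouin zone; §1.2
item 2, p.4 L8–11 uses `-[L/2] ≤ nᵢ ≤ [(L-1)/2]`, the same set modulo `2πℤ²`). [cite: BenfattoGiulianiMastropietro2003, §1.2 p.4 (L8–11)] -/
def torusMomentum (L : ℕ) (n : Fin 2 → Fin L) : Fin 2 → ℝ := fun i => 2 * π * ((n i : ℕ) : ℝ) / L

/-- The translation-invariant one-body kernel on the torus with momentum-space symbol `c(k⃗)`: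
`h_c(x⃗, y⃗) = L⁻² Σ_n c(k⃗_n) e^{-ik⃗_n·(x⃗-y⃗)}` (the quadratic form
`(L²β)⁻¹ Σ_k c(k⃗) ψ̂⁺_k ψ̂⁻_k` of (2.6)/(2.10) in the position basis, conventions (2.3)–(2.4)). [cite: BenfattoGiulianiMastropietro2003, §1.2 (2.3)–(2.6), (2.10) p.4 (L34–64, L74–75)] -/
def torusKernel (L : ℕ) (c : (Fin 2 → ℝ) → ℝ) (x y : FermionTorus 2 L) : ℂ :=
  ((L : ℂ) ^ 2)⁻¹ * ∑ n : Fin 2 → Fin L, ((c (torusMomentum L n) : ℝ) : ℂ) *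
    Complex.exp (-(Complex.I * ∑ i : Fin 2,
      ((torusMomentum L n i : ℝ) : ℂ) * ((((ofLex x i : ℕ) : ℝ) : ℂ) - (((ofLex y i : ℕ) : ℝ) : ℂ))))

/-- The one-body matrix on the orbitals `(x⃗, σ)` of the torus: spin-diagonal, kernel `h_c`. [cite: BenfattoGiulianiMastropietro2003, §1.2 (2.1)–(2.2) p.4 (L15–25)] -/
def oneBody (L : ℕ) (c : (Fin 2 → ℝ) → ℝ) :
    Matrix (Orb (FermionTorus 2 L)) (Orb (FermionTorus 2 L)) ℂ :=
  fun a b => if (ofLex a).2 = (ofLex b).2 then torusKernel L c (ofLex a).1 (ofLex b).1 else 0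

/-- The periodisation `v^L_{σσ'}(z⃗) = Σ_{m ∈ ℤ²} v_{σσ'}(z⃗ + Lm⃗)` of the pair potential to the torus
(finite-volume convention; summable under the decay hypothesis of p.4 L84–85). [cite: BenfattoGiulianiMastropietro2003, §1.2 (2.8) p.4 (L80–85)] -/
def periodisedPotential (L : ℕ) (v : Fin 2 → Fin 2 → Site 2 → ℝ) (σ σ' : Fin 2)
    (z : Fin 2 → Fin L) : ℝ :=
  ∑' m : Fin 2 → ℤ, v σ σ' (fun i => ((z i : ℕ) : ℤ) + L * m i)

/-- The density–density interaction on the torus,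
`V_L = Σ_{x⃗,y⃗} Σ_{σσ'} v^L_{σσ'}(x⃗-y⃗) a⁺_{xσ} a⁺_{yσ'} a⁻_{yσ'} a⁻_{xσ}` — the normal-ordered operator
whose Grassmann (coherent-state) action is `Σ ∫ δ(x₀-y₀) v ψ⁺_{xσ}ψ⁻_{xσ}ψ⁺_{yσ'}ψ⁻_{yσ'}` of (2.8)
(equal to `Σ v n_{xσ}n_{yσ'}` off the diagonal `(x⃗,σ) = (y⃗,σ')`, where both sides vanish). [cite: BenfattoGiulianiMastropietro2003, §1.2 (2.8) p.4 (L80–85)] -/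
def interaction (L : ℕ) (v : Fin 2 → Fin 2 → Site 2 → ℝ) :
    Matrix (Finset (Orb (FermionTorus 2 L))) (Finset (Orb (FermionTorus 2 L))) ℂ :=
  ∑ x : FermionTorus 2 L, ∑ y : FermionTorus 2 L, ∑ σ : Fin 2, ∑ σ' : Fin 2,
    ((periodisedPotential L v σ σ' (fun i => ofLex x i - ofLex y i) : ℝ) : ℂ) •
      (creation (orb x σ) * creation (orb y σ') * annihilation (orb y σ') * annihilation (orb x σ))

/-- **The BGM 2003 lattice Hamiltonian on the torus of side `L`** with dispersion `ε`, chemical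
potential `μ`, counterterm `ν̂` (a function on the Brillouin zone) and coupling `λ`:
`H_L = dΓ(h_{ε - μ + ν̂}) + λ V_L` — the Hamiltonian whose imaginary-time Schwinger functions are the
`M → ∞` limit of the Grassmann integrals (2.9) with `𝒱 + 𝒩` (Remark p.4 L125–129). [cite: BenfattoGiulianiMastropietro2003, §1.2 (2.6)–(2.10) and Remark p.4 (L60–135)] -/
def hamiltonian (ε : (Fin 2 → ℝ) → ℝ) (μ : ℝ) (ν : (Fin 2 → ℝ) → ℝ) (lam : ℝ)
    (v : Fin 2 → Fin 2 → Site 2 → ℝ) (L : ℕ) :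
    Matrix (Finset (Orb (FermionTorus 2 L))) (Finset (Orb (FermionTorus 2 L))) ℂ :=
  dGamma (oneBody L fun k => ε k - μ + ν k) + ((lam : ℝ) : ℂ) • interaction L v

/-- **The finite-volume two-point Schwinger function** `S^{L,β}(x, σ, -; y, σ, +) = ⟨T ψ⁻_{x σ} ψ⁺_{y σ}⟩`
of the torus model at inverse temperature `β`, `x = (x₀, x⃗)`, `y = (y₀, y⃗)` with `x⃗, y⃗ ∈ ℤ²` read
modulo `L` (2.9 at finite `L`, `n = 2`; fermionic time ordering as in the tree's
`Matrix.schwingerTwoPoint`; junk `0` for `L = 0`). [cite: BenfattoGiulianiMastropietro2003, §1.2 (2.9) p.4 (L66–70, L138–140)] -/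
def schwingerL (ε : (Fin 2 → ℝ) → ℝ) (μ : ℝ) (ν : (Fin 2 → ℝ) → ℝ) (lam : ℝ)
    (v : Fin 2 → Fin 2 → Site 2 → ℝ) (β : ℝ) (L : ℕ) (σ : Fin 2)
    (x₀ : ℝ) (x : Site 2) (y₀ : ℝ) (y : Site 2) : ℂ :=
  if hL : L = 0 then 0
  else
    haveI : NeZero L := ⟨hL⟩
    Matrix.schwingerTwoPoint β (hamiltonian ε μ ν lam v L)
      (annihilation (orb (FermionTorus.ofTorusSite (Torus.proj L x)) σ))
      (creation (orb (FermionTorus.ofTorusSite (Torus.proj L y)) σ)) x₀ y₀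

/-- **The free propagator at finite `β`** (lattice case, `C̄₀⁻¹ = 1`): `ĝ(k) = 1/(-ik₀ + ε(k⃗) - μ)`
(2.2), the Fourier transform of `lim_{L→∞} g^{L,β}` (2.3). No counterterm: `ν̂` is part of the
interaction. [cite: BenfattoGiulianiMastropietro2003, §1.2 (2.2)–(2.3) p.4 (L21–39) and Thm 1.1 p.5 (L10–12)] -/
def freePropagator (ε : (Fin 2 → ℝ) → ℝ) (μ k₀ : ℝ) (k : Fin 2 → ℝ) : ℂ :=
  (-(Complex.I * k₀) + (((ε k - μ : ℝ)) : ℂ))⁻¹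

/-- The Matsubara frequencies `k₀ = (2π/β)(m + ½)`, `m ∈ ℤ` (§1.2 p.4 L9). [cite: BenfattoGiulianiMastropietro2003, §1.2 p.4 (L8–9)] -/
def matsubara (β : ℝ) (m : ℤ) : ℝ := 2 * π / β * ((m : ℝ) + 1 / 2)

/-- **The Fourier transform of the infinite-volume two-point function**,
`Ŝ(k₀, k⃗) = ∫₀^β dx₀ Σ_{x⃗ ∈ ℤ²} e^{i(k₀x₀ + k⃗·x⃗)} S(x₀, x⃗)` (conventions (2.3)–(2.4): `S(x - y)`
with `y = 0`; `S` antiperiodic of period `β` in `x₀`, so `k₀` is a Matsubara frequency). [cite: BenfattoGiulianiMastropietro2003, §1.2 (2.3)–(2.4) p.4 (L34–44) and Thm 1.1 (2.11) p.5 (L8)] -/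
def fourierTwoPoint (β : ℝ) (S : ℝ → Site 2 → ℂ) (k₀ : ℝ) (k : Fin 2 → ℝ) : ℂ :=
  ∫ x₀ in (0 : ℝ)..β, ∑' x : Site 2,
    Complex.exp (Complex.I * (((k₀ * x₀ + ∑ i : Fin 2, k i * (x i : ℝ) : ℝ)) : ℂ)) * S x₀ x

/-! ### The lattice model class (predicate, never asserted) -/

/-- **BGM 2003 §1.2, the LATTICE model class** (p.4 L1–13, L23–27, L84–85, L97–123): the dispersion
`ε` is a function on the Brillouin zone (`2πℤ²`-periodic on `ℝ²`), `≥ 0`, vanishing exactly at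
`k⃗ = 0 (mod 2πℤ²)` («strictly positive for `k⃗ ≠ 0` and equal to `0` for `k⃗ = 0`»); it satisfies the
geometric hypotheses items 1, 3, 4 / (2.8a)–(2.8c) (`DispersionHyp`, file `BGM2003Sectors`) with the
shell `{|ε - μ| ≤ e₀}` in the zone being EXACTLY the annulus `ℬ` of the polar chart (the level curves
`Σ(e)`, `|e| ≤ e₀`, «encircling the origin»), `e₀ < μ` (p.4 L101–102); the pair potential
`v_{σσ'} : ℤ² → ℝ` has `max_{σσ'} Σ_{x⃗} (1 + |x⃗|²)|v_{σσ'}(x⃗)| < ∞` (p.4 L84–85; on the lattice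
"smooth" is void). A PREDICATE: nothing is asserted. [cite: BenfattoGiulianiMastropietro2003, §1.2 p.4 (L1–13, L23–27, L84–123)] -/
structure LatticeModelHyp (ε : (Fin 2 → ℝ) → ℝ) (μ e₀ : ℝ) (u : ℝ → ℝ → ℝ)
    (v : Fin 2 → Fin 2 → Site 2 → ℝ) : Prop where
  dispersion : DispersionHyp ε μ e₀ u
  periodic : ∀ (m : Fin 2 → ℤ) (k : Fin 2 → ℝ), ε (k + fun i => 2 * π * (m i : ℝ)) = ε k
  nonneg : ∀ k : Fin 2 → ℝ, 0 ≤ ε k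
  eq_zero_iff : ∀ k : Fin 2 → ℝ, ε k = 0 ↔ ∃ m : Fin 2 → ℤ, k = fun i => 2 * π * (m i : ℝ)
  e₀_lt : e₀ < μ
  shell_eq : ∀ k : Fin 2 → ℝ, |ε k - μ| ≤ e₀ →
    ∃ (θ e : ℝ) (m : Fin 2 → ℤ), |e| ≤ e₀ ∧ k = levelPoint u θ e + fun i => 2 * π * (m i : ℝ)
  potential_summable : ∀ σ σ' : Fin 2,
    Summable fun x : Site 2 => (1 + ∑ i : Fin 2, ((x i : ℝ)) ^ 2) * |v σ σ' x|

/-! ### Theorem 1.1 (lattice case) as a named fact -/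

/-- **BGM 2003 Theorem 1.1 [th2.1], (2.11) — lattice models, COUNTERTERM version (named fact).**
For a lattice model of the class `LatticeModelHyp ε μ e₀ u v` there exist `λ₀ > 0` (the paper's `ε`),
`c₀ > 0` («only depending on first and second order terms»), `c > 0`, `C` and a counterterm
`ν̂(k⃗, λ)` — CONTINUOUS in `(k⃗, λ)`, `2πℤ²`-periodic in `k⃗`, `|ν̂| ≤ C|λ|` («`= O(λ)`») with `C`
uniform, and allowed to depend on the temperature (the print suppresses `β`; the proof, Thm 4.2
p.22 L59–70, constructs it at each `β` as a fixed point with scales `h ≥ h_β`; a `β`-uniform choice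
is not claimed) — such that for all `|λ| ≤ λ₀` and all `β > 0` with `c₀|λ| log β ≤ 1`
(= «`T ≥ exp{-(c₀|λ|)⁻¹}`»), for each spin `σ`: the two-point Schwinger function of the model WITH
counterterm `ν̂(·,λ;β)` has an infinite-volume limit `S(x₀, x⃗) = lim_{L→∞} S^{L,β}((x₀,x⃗),σ,-;(0,0⃗),σ,+)`
(2.9) for `x₀ ∈ [0, β)` (the time torus, p.4 L1–6), summable over `x⃗ ∈ ℤ²` with an `x₀`-integrable
Fourier sum, and its Fourier transform satisfies
`Ŝ(k) = ĝ(k)(1 + λŜ₁(k))` with `|Ŝ₁(k)| ≤ c` at every Matsubara `k₀` and every `k⃗` (2.11), `ĝ` the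
free propagator `1/(-ik₀ + ε(k⃗) - μ)`. The continuum half of the printed theorem (and its jellium
clause `ν̂ = ν(λ)`) is not typed (module doc). The inversion `ε₀ = ε + ν̂ ↦ ε` is OPEN (p.5 L44–64) and
is no part of this statement. Unproved here. [cite: BenfattoGiulianiMastropietro2003, Thm 1.1 (2.11) p.5 (L1–15)] -/
def theorem11_lattice : Prop :=
  ∀ (ε : (Fin 2 → ℝ) → ℝ) (μ e₀ : ℝ) (u : ℝ → ℝ → ℝ) (v : Fin 2 → Fin 2 → Site 2 → ℝ),
    LatticeModelHyp ε μ e₀ u v →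
    ∃ (lam₀ c₀ c C : ℝ) (ν : (Fin 2 → ℝ) → ℝ → ℝ → ℝ), 0 < lam₀ ∧ 0 < c₀ ∧ 0 < c ∧
      (∀ β : ℝ, Continuous fun q : (Fin 2 → ℝ) × ℝ => ν q.1 q.2 β) ∧
      (∀ (k : Fin 2 → ℝ) (lam β : ℝ), |lam| ≤ lam₀ → 0 < β → |ν k lam β| ≤ C * |lam|) ∧
      (∀ (m : Fin 2 → ℤ) (k : Fin 2 → ℝ) (lam β : ℝ),
        ν (k + fun i => 2 * π * (m i : ℝ)) lam β = ν k lam β) ∧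
      ∀ (lam β : ℝ), |lam| ≤ lam₀ → 0 < β → c₀ * |lam| * Real.log β ≤ 1 → ∀ σ : Fin 2,
        ∃ S : ℝ → Site 2 → ℂ,
          (∀ x₀ ∈ Set.Ico 0 β, ∀ x : Site 2,
            Tendsto (fun L : ℕ => schwingerL ε μ (fun k => ν k lam β) lam v β L σ x₀ x 0 0) atTop
              (𝓝 (S x₀ x))) ∧
          (∀ x₀ ∈ Set.Ico 0 β, Summable fun x : Site 2 => ‖S x₀ x‖) ∧
          (∀ (k₀ : ℝ) (k : Fin 2 → ℝ), IntervalIntegrable (fun x₀ : ℝ => ∑' x : Site 2,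
              Complex.exp (Complex.I * (((k₀ * x₀ + ∑ i : Fin 2, k i * (x i : ℝ) : ℝ)) : ℂ)) * S x₀ x)
            volume 0 β) ∧
          ∃ S₁ : ℝ → (Fin 2 → ℝ) → ℂ, (∀ (k₀ : ℝ) (k : Fin 2 → ℝ), ‖S₁ k₀ k‖ ≤ c) ∧
            ∀ (m : ℤ) (k : Fin 2 → ℝ),
              fourierTwoPoint β S (matsubara β m) k =
                freePropagator ε μ (matsubara β m) k * (1 + lam * S₁ (matsubara β m) k)

end BGM2003

end Literature.MathematicalPhysics.QuantumLattice.FermiRG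

end
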